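import Literature.Analysis.FunctionSpaces.PoissonPointProcessUniqueness
import Literature.Probability.Process.PoissonCloud
import Literature.Probability.Process.PoissonCloudProofs
import HarnessLib

/-!
# Poisson point processes: existence from Kingman's Poisson clouds

(topic Analysis/FunctionSpaces; DISCHARGES the named fact
`Literature.Analysis.FunctionSpaces.existsUnique_isPoissonPointProcess` of
`Literature.Analysis.FunctionSpaces.PoissonPointProcess` as
`existsUnique_isPoissonPointProcess_holds`.)

A Poisson process in Kingman's sense is a random countable SET `X : Ω → Set E` with Poisson
counts (`Literature.Probability.Process.IsPoissonCloud ν X P`, file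
`Probability/Process/PoissonCloud`); the tree's `IsPoissonPointProcess ν Q` is the corresponding
notion for a LAW `Q` on locally finite simple configurations `PointConfig E` of a topological
space. This file passes from the former to the latter when the intensity `ν` is locally finite
on a second countable space (J. F. C. Kingman, *Poisson Processes* (1993), §2.1, p. 14: if
`μ(A)`, and therefore `N(A)`, is finite on bounded sets, "then with probability 1 the set `Π` is
locally finite"):

* `exists_isPoissonPointProcess_of_isPoissonCloud` — given a Poisson cloud `X` with locally finite
  intensity `ν`, choose countably many open sets `Uₙ` of finite intensity covering `E`
  (`Measure.finiteSpanningSetsInOpen'`); almost surely every `X ∩ Uₙ` is finite (its count is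
  Poisson), and then `X` meets every compact set in a finite set (finite subcover), i.e. `X` is a
  locally finite configuration; the resulting random configuration `Φ` (`:= X` on this event, `∅`
  off it) is measurable for the count σ-algebra (`PointConfig.measurable_of_count`), its counts
  agree a.s. with those of `X`, and its law `P ∘ Φ⁻¹` satisfies Kingman's axioms (i)–(ii);
* `existsUnique_isPoissonPointProcess_of_exists_isPoissonCloud` — the named fact
  `existsUnique_isPoissonPointProcess` (existence AND uniqueness on a second countable locally
  compact Hausdorff space, for a locally finite intensity without atoms) follows from Kingman's
  Existence Theorem for clouds (the named fact
  `Literature.Probability.Process.exists_isPoissonCloud`, Kingman 1993, §2.5: an s-finite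
  non-atomic measure on a space with measurable diagonal is the mean measure of a Poisson process)
  and the uniqueness theorem `IsPoissonPointProcess.unique_holds` of
  `PoissonPointProcessUniqueness` (Kingman 1993, §2.1, (2.5); Rényi 1967);
* `existsUnique_isPoissonPointProcess_holds` — the discharge: Kingman's Existence Theorem for
  clouds is PROVED in the tree (`Literature.Probability.Process.exists_isPoissonCloud_holds`, file
  `Probability/Process/PoissonCloudProofs`: superposition of independent finite Poisson batches),
  so the previous item applies unconditionally.

No new definitions, no new named facts.

## References

* J. F. C. Kingman, *Poisson Processes*, Oxford Studies in Probability 3, Oxford University Press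
  (1993), §2.1 (pp. 11–14), §2.5 Existence Theorem (p. 23). [cite: Kingman1993, §2.5]
-/

open MeasureTheory ProbabilityTheory Set
open scoped ENNReal NNReal

universe u

namespace Literature.Analysis.FunctionSpaces

open Literature.Probability.Process (IsPoissonCloud exists_isPoissonCloud
  exists_isPoissonCloud_holds)

/-! ### Transport of independence along a measurable map -/

/-- Independence of a family of random variables transports along a measurable change of
variables: if the `g i ∘ T` are independent under `μ`, then the `g i` are independent under the
image measure `μ.map T` (both say `μ (T ⁻¹' ⋂ᵢ g i ⁻¹' Bᵢ) = ∏ᵢ μ (T ⁻¹' (g i ⁻¹' Bᵢ))` for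
finitely many measurable `Bᵢ`). [folklore] -/
theorem iIndepFun_map_of_comp_measurable {Ω Ω' ι : Type*} [MeasurableSpace Ω]
    [MeasurableSpace Ω'] {β : ι → Type*} [∀ i, MeasurableSpace (β i)] {μ : Measure Ω}
    {T : Ω → Ω'} (hT : Measurable T) {g : ∀ i, Ω' → β i} (hg : ∀ i, Measurable (g i))
    (h : iIndepFun (fun i => g i ∘ T) μ) : iIndepFun g (μ.map T) := by
  rw [iIndepFun_iff_measure_inter_preimage_eq_mul] at h ⊢
  intro S sets hsets
  have hmeas : ∀ i ∈ S, MeasurableSet (g i ⁻¹' sets i) := fun i hi => hg i (hsets i hi)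
  have h1 : ∀ i ∈ S, μ.map T (g i ⁻¹' sets i) = μ ((g i ∘ T) ⁻¹' sets i) := fun i hi => by
    rw [Measure.map_apply hT (hmeas i hi), Set.preimage_comp]
  rw [Finset.prod_congr rfl h1, Measure.map_apply hT (Finset.measurableSet_biInter S hmeas),
    Set.preimage_iInter₂]
  simpa only [Set.preimage_comp] using h S hsets

/-! ### From a Poisson cloud to a law on locally finite configurations -/

section Cloud

variable {Ω : Type*} [MeasurableSpace Ω] {E : Type*} [TopologicalSpace E] [MeasurableSpace E]
  {ν : Measure E} {X : Ω → Set E} {P : Measure Ω}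

omit [TopologicalSpace E] in
/-- Under a Poisson cloud, a measurable set of finite intensity almost surely contains finitely
many points (Kingman 1993, §2.1, p. 11: "if `μ(A)` is finite, `Π ∩ A` is with probability 1 a
finite set"). [cite: Kingman1993, §2.1, p. 11] -/
theorem ae_encard_inter_lt_top_of_isPoissonCloud (h : IsPoissonCloud ν X P) {s : Set E}
    (hs : MeasurableSet s) (hν : ν s ≠ ∞) : ∀ᵐ ω ∂P, (X ω ∩ s).encard < ⊤ := by
  rw [ae_iff]
  have hm := h.measurable_encard hs
  have h1 : {ω | ¬ (X ω ∩ s).encard < ⊤} = (fun ω => (X ω ∩ s).encard) ⁻¹' {⊤} := by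
    ext
    simp
  rw [h1, ← Measure.map_apply hm (measurableSet_singleton _), h.map_encard hs hν,
    Measure.map_apply measurable_from_top (measurableSet_singleton _)]
  have h2 : ((↑) : ℕ → ℕ∞) ⁻¹' {⊤} = ∅ := by
    ext
    simp
  simp [h2]

omit [MeasurableSpace E] in
/-- A set which meets each member of a countable open cover in a finite set meets every compact
set in a finite set (finite subcover; Kingman 1993, §2.1, p. 14: "with probability 1 the set `Π`
is locally finite"). [folklore] -/
theorem finite_inter_isCompact_of_cover {Y : Set E} {U : ℕ → Set E} (hU : ∀ n, IsOpen (U n))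
    (hcov : ⋃ n, U n = univ) (hfin : ∀ n, (Y ∩ U n).Finite) {K : Set E} (hK : IsCompact K) :
    (Y ∩ K).Finite := by
  obtain ⟨b, -, hbfin, hKb⟩ := hK.elim_finite_subcover_image (b := univ) (c := U)
    (fun n _ => hU n) (by rw [Set.biUnion_univ, hcov]; exact subset_univ K)
  refine (hbfin.biUnion fun n _ => hfin n).subset ?_
  rintro x ⟨hxY, hxK⟩
  obtain ⟨n, hn, hxn⟩ := Set.mem_iUnion₂.1 (hKb hxK)
  exact Set.mem_iUnion₂.2 ⟨n, hn, hxY, hxn⟩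

/-- **From a Poisson cloud to a Poisson point process on locally finite configurations**
(Kingman 1993, §2.1, pp. 11 and 14): if `X` is a Poisson cloud (random countable set with
independent Poisson counts) whose intensity `ν` is locally finite on a second countable space,
then almost surely `X` is a locally finite configuration — cover the space by countably many open
sets of finite intensity, each of which a.s. contains finitely many points — and the law of the
random configuration `X` (set to `∅` on the exceptional null event) is a Poisson point process with
intensity `ν` in the sense of `IsPoissonPointProcess`: its counts agree a.s. with those of `X`, so
they are Poisson (i) and independent over disjoint sets (ii). [cite: Kingman1993, §2.1, pp. 11–14] -/
theorem exists_isPoissonPointProcess_of_isPoissonCloud [SecondCountableTopology E]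
    [OpensMeasurableSpace E] [IsLocallyFiniteMeasure ν] (h : IsPoissonCloud ν X P) :
    ∃ Q : Measure (PointConfig E), IsPoissonPointProcess ν Q := by
  classical
  haveI := h.isProbabilityMeasure
  -- a spanning sequence of open sets of finite intensity
  set T := ν.finiteSpanningSetsInOpen' with hT
  have hUo : ∀ n, IsOpen (T.set n) := fun n => T.set_mem n
  have hUm : ∀ n, MeasurableSet (T.set n) := fun n => (hUo n).measurableSet
  -- the good event: finitely many points in each `T.set n`
  have hgood_meas : MeasurableSet {ω | ∀ n, (X ω ∩ T.set n).encard < ⊤} := by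
    rw [Set.setOf_forall]
    exact MeasurableSet.iInter fun n => h.measurable_encard (hUm n) MeasurableSet.of_discrete
  have hgood_ae : ∀ᵐ ω ∂P, ∀ n, (X ω ∩ T.set n).encard < ⊤ :=
    ae_all_iff.2 fun n => ae_encard_inter_lt_top_of_isPoissonCloud h (hUm n) (T.finite n).ne
  -- on the good event the cloud is a locally finite configuration
  have hlf : ∀ ω, (∀ n, (X ω ∩ T.set n).encard < ⊤) → ∀ K, IsCompact K → (X ω ∩ K).Finite :=
    fun ω hω K hK => finite_inter_isCompact_of_cover hUo T.spanning
      (fun n => Set.encard_lt_top_iff.1 (hω n)) hK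
  -- the random configuration
  set Φ : Ω → PointConfig E := fun ω =>
    if hω : ∀ n, (X ω ∩ T.set n).encard < ⊤ then ⟨X ω, hlf ω hω⟩ else ∅ with hΦ
  have hΦcount : ∀ (s : Set E) (ω : Ω), (Φ ω).count s =
      if (∀ n, (X ω ∩ T.set n).encard < ⊤) then (X ω ∩ s).encard else 0 := by
    intro s ω
    by_cases hω : ∀ n, (X ω ∩ T.set n).encard < ⊤
    · simp only [hΦ, dif_pos hω, if_pos hω, PointConfig.count]
    · simp only [hΦ, dif_neg hω, if_neg hω, PointConfig.count_empty]
  have hΦm_count : ∀ s, MeasurableSet s → Measurable fun ω => (Φ ω).count s := by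
    intro s hs
    simp_rw [hΦcount s]
    exact Measurable.ite hgood_meas (h.measurable_encard hs) measurable_const
  have hΦm : Measurable Φ := PointConfig.measurable_of_count hΦm_count
  have hΦae : ∀ s, (fun ω => (Φ ω).count s) =ᵐ[P] fun ω => (X ω ∩ s).encard := by
    intro s
    filter_upwards [hgood_ae] with ω hω
    rw [hΦcount s, if_pos hω]
  refine ⟨P.map Φ, Measure.isProbabilityMeasure_map hΦm.aemeasurable, fun s hs hν => ?_,
    fun n s hs hd => ?_⟩
  · -- (i) the counts are Poisson
    rw [Measure.map_map (PointConfig.measurable_count hs) hΦm]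
    change P.map (fun ω => (Φ ω).count s) = _
    rw [Measure.map_congr (hΦae s)]
    exact h.map_encard hs hν
  · -- (ii) counts of disjoint sets are independent
    refine iIndepFun_map_of_comp_measurable hΦm (fun i => PointConfig.measurable_count (hs i)) ?_
    exact (iIndepFun_congr fun i => (hΦae (s i)).symm).1 (h.iIndepFun_encard hs hd)

end Cloud

/-! ### Existence and uniqueness from Kingman's Existence Theorem for clouds -/

section Main

variable {E : Type u} [TopologicalSpace E] [MeasurableSpace E]

/-- **Existence and uniqueness of the Poisson point process, from Kingman's Existence Theorem for
Poisson clouds**: assuming the named fact `Literature.Probability.Process.exists_isPoissonCloud`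
(Kingman 1993, §2.5 Existence Theorem: a non-atomic s-finite measure on a space with measurable
diagonal is the mean measure of a Poisson process), on a second countable locally compact
Hausdorff space every locally finite Borel measure `ν` without atoms — which is σ-finite, hence
s-finite, and the diagonal of `E` is closed hence measurable — is the intensity of a Poisson point
process on locally finite configurations (`exists_isPoissonPointProcess_of_isPoissonCloud`), unique
by `IsPoissonPointProcess.unique_holds` (Kingman 1993, §2.1, (2.5); Rényi 1967).
[cite: Kingman1993, §2.5 Existence Theorem, p. 23] -/
theorem existsUnique_isPoissonPointProcess_of_exists_isPoissonCloud
    (hcloud : exists_isPoissonCloud.{u}) : existsUnique_isPoissonPointProcess (E := E) := by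
  intro _ _ _ _ ν _ hν
  obtain ⟨Ω, _, P, X, hX⟩ := hcloud ν measurableSet_diagonal inferInstance hν
  obtain ⟨Q, hQ⟩ := exists_isPoissonPointProcess_of_isPoissonCloud hX
  exact ⟨Q, hQ, fun Q' hQ' => (IsPoissonPointProcess.unique_holds hQ hQ').symm⟩

/-- **Existence Theorem with uniqueness** (discharge of the named fact
`existsUnique_isPoissonPointProcess`; Kingman 1993, §2.5 Existence Theorem, p. 23, with the
uniqueness of §2.1, (2.5) / Rényi 1967): on a second countable locally compact Hausdorff space,
every locally finite Borel measure without atoms is the intensity of a unique Poisson point process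
on locally finite simple configurations. Proof: Kingman's Existence Theorem for Poisson clouds
(`Literature.Probability.Process.exists_isPoissonCloud_holds`) and
`existsUnique_isPoissonPointProcess_of_exists_isPoissonCloud`.
[cite: Kingman1993, §2.5 Existence Theorem, p. 23] -/
theorem existsUnique_isPoissonPointProcess_holds : existsUnique_isPoissonPointProcess (E := E) :=
  existsUnique_isPoissonPointProcess_of_exists_isPoissonCloud exists_isPoissonCloud_holds

end Main

end Literature.Analysis.FunctionSpaces
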